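import Mathlib
import HarnessLib
import Summits.HubbardSuperconductivity.HubbardSuperconductivity.Theorems.KLProgrammeKLRegimeVolumeLimitSunsetFrame
import Summits.HubbardSuperconductivity.HubbardSuperconductivity.Theorems.KLProgrammeKLRegimeTwoPointAssemblyIteratedTannery
import Summits.HubbardSuperconductivity.HubbardSuperconductivity.Theorems.KLProgrammeKLRegimeTwoPointAssemblyLimitDefs

/-!
# Child `KLRegimeVolumeLimit` (stmt-HubbardSuperconductivity-19665 / its gen-3 twin) — the ORDER-`U²` RUNG: the sunset sum of the
# true carrier IS k3c4-p1's finite-volume sunset functional at the bare symbol (seat hubbard-kl-k3c5-p3)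

The Wick evaluation of the second `U`-derivative of the VL carrier (`…SecondOrderEval`) produces the momentum-space sunset sum of the
BARE torus propagator `ĝ₀(k) = 1/(−iω_k + ξ(k⃗))` (`propCT … 0`),

  `Sun(k) = Σ_{k₂,k₃,k₄ : n(k)+n(k₃) = n(k₂)+n(k₄), k⃗+k⃗₃ = k⃗₂+k⃗₄} ĝ₀(k₂) ĝ₀(k₃) ĝ₀(k₄)`

(sums over the `2M` kept frequency labels × the torus momenta, exact conservation).  The model-free sunset rung of the VL text
(`…VolumeLimitSunset.klSunset_volLimit`, seat k3c4-p1) is stated for the functional `klSunset L M β g (ω,k⃗) σ =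
Σ_{(a,b)} [a,b,n+b−a kept] β⁻² L⁻²Σ_p L⁻²Σ_q g_a(p_p) g_b(p_q) g_{n+b−a}(p_{k⃗+q−p})` of a continuum symbol family `g`.  This module proves

  **`Sun(k) / (βL²)² = klSunset L M β g₀ k σ`**,  `g₀ a x = (ξ(x) − iω_a)⁻¹ = (bandCT μ 0 x − i·fermiMatsubara β a)⁻¹`

(`sunsetSum_div_eq_klSunset`): the bare propagator on the grid is the bare symbol at `(matsubaraInt, latticeMomentum)`
(`propCT_zero_eq_bareSymbol`), the constrained `k₂`-sum collapses onto the conserved label whenever it is kept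
(`sum_vertexConstraint_collapse`), and the Matsubara sums re-index over `[-M, M) = [-M, M-1]`.  Hence (`sunsetSum_volLimit`) the three
clauses of `FinalTwoLegVolLimit` for `Sun/(βL²)²` by `klSunset_frame_volLimit` at the trivial frame.  Pure bookkeeping; no definition.
-/

noncomputable section

namespace Summit.HubbardSuperconductivity.HubbardSuperconductivity.Theorems.TwoPointAssembly

set_option linter.dupNamespace false -- summit = problem name (single-conjunct summit), D-0017

open Finset Filter Topology Literature.MathematicalPhysics.QuantumLattice Literature.Probability.LatticeModels
open Summit.HubbardSuperconductivity.HubbardSuperconductivity.Theorems.KLRegimeSplit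

variable {L M : ℕ} [NeZero L]

/-! ## §1 The bare propagator on the grid is the bare symbol -/

omit [NeZero L] in
/-- **`ĝ₀(ι, q) = g₀ (n_ι) (p_q)`** with the bare symbol `g₀ a x = (bandCT μ 0 x − i·ω_a)⁻¹`. -/
theorem propCT_zero_eq_bareSymbol (β μ : ℝ) (ι : MatsubaraIdx M) (q : TorusSite 2 L) :
    propCT L M β μ 0 (ι, q) =
      ((bandCT μ 0 (latticeMomentum L q) : ℂ) - Complex.I * (fermiMatsubara β (matsubaraInt M ι) : ℂ))⁻¹ := by
  rw [propCT, one_div, nambuXiCT_eq_bandCT]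
  congr 1
  rw [show matsubaraFreq β M ι = fermiMatsubara β (matsubaraInt M ι) from rfl]
  ring

/-! ## §2 Collapsing the constrained sum and re-indexing the Matsubara window -/

/-- The kept window as a closed interval: `[-M, M-1] = [-M, M)`. -/
theorem Icc_neg_sub_one_eq_Ico (M : ℕ) : Finset.Icc (-(M : ℤ)) ((M : ℤ) - 1) = Finset.Ico (-(M : ℤ)) M := by
  rw [← Finset.Ico_add_one_right_eq_Icc, sub_add_cancel]

omit [NeZero L] in
/-- A Matsubara sum of a guarded label: `Σ_ι [n_ι = m] x = [m ∈ [-M, M)] x`. -/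
theorem sum_ite_matsubaraInt_eq (m : ℤ) (H : ℤ → ℂ) :
    ∑ ι : MatsubaraIdx M, (if matsubaraInt M ι = m then H (matsubaraInt M ι) else 0) =
      if m ∈ Finset.Ico (-(M : ℤ)) M then H m else 0 := by
  rw [sum_matsubaraIdx_eq_sum_Ico M (fun j => if j = m then H j else 0), Finset.sum_ite_eq']

/-- **Collapse of the constrained leg**: `Σ_{k₂} [n + n₃ = n₂ + n₄ ∧ k⃗ + k⃗₃ = k⃗₂ + k⃗₄] G(n₂, k⃗₂) = [n + n₃ − n₄ kept] G(n + n₃ − n₄, k⃗ + k⃗₃ − k⃗₄)`. -/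
theorem sum_vertexConstraint_collapse (k k₃ k₄ : FreqMomentum L M) (G : ℤ → TorusSite 2 L → ℂ) :
    ∑ k₂ : FreqMomentum L M,
        (if matsubaraInt M k.1 + matsubaraInt M k₃.1 = matsubaraInt M k₂.1 + matsubaraInt M k₄.1 ∧ k.2 + k₃.2 = k₂.2 + k₄.2 then
          G (matsubaraInt M k₂.1) k₂.2 else 0) =
      if matsubaraInt M k.1 + matsubaraInt M k₃.1 - matsubaraInt M k₄.1 ∈ Finset.Ico (-(M : ℤ)) M then
        G (matsubaraInt M k.1 + matsubaraInt M k₃.1 - matsubaraInt M k₄.1) (k.2 + k₃.2 - k₄.2) else 0 := by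
  have hcond : ∀ k₂ : FreqMomentum L M,
      (matsubaraInt M k.1 + matsubaraInt M k₃.1 = matsubaraInt M k₂.1 + matsubaraInt M k₄.1 ∧ k.2 + k₃.2 = k₂.2 + k₄.2) ↔
        (matsubaraInt M k₂.1 = matsubaraInt M k.1 + matsubaraInt M k₃.1 - matsubaraInt M k₄.1 ∧ k₂.2 = k.2 + k₃.2 - k₄.2) := by
    intro k₂
    constructor
    · rintro ⟨h1, h2⟩; exact ⟨by omega, by rw [eq_sub_iff_add_eq, ← h2]⟩
    · rintro ⟨h1, h2⟩; exact ⟨by omega, by rw [h2, sub_add_cancel]⟩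
  simp only [hcond]
  rw [Fintype.sum_prod_type]
  simp only [ite_and]
  have hinner : ∀ ι : MatsubaraIdx M, (∑ p : TorusSite 2 L,
      if matsubaraInt M ι = matsubaraInt M k.1 + matsubaraInt M k₃.1 - matsubaraInt M k₄.1 then
        (if p = k.2 + k₃.2 - k₄.2 then G (matsubaraInt M ι) p else 0) else 0) =
      if matsubaraInt M ι = matsubaraInt M k.1 + matsubaraInt M k₃.1 - matsubaraInt M k₄.1 then
        G (matsubaraInt M ι) (k.2 + k₃.2 - k₄.2) else 0 := by
    intro ι
    split_ifs with h
    · rw [Finset.sum_ite_eq' Finset.univ (k.2 + k₃.2 - k₄.2), if_pos (Finset.mem_univ _)]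
    · simp
  simp only [hinner]
  exact sum_ite_matsubaraInt_eq _ (fun m => G m (k.2 + k₃.2 - k₄.2))

/-! ## §3 The sunset sum of the bare propagator is `klSunset` at the bare symbol -/

/-- **`Sun(k)/(βL²)² = klSunset L M β g₀ k σ`** for the bare torus propagator and the bare continuum symbol
`g₀ a x = (bandCT μ 0 x − i·ω_a)⁻¹`. -/
theorem sunsetSum_div_eq_klSunset (β μ : ℝ) (k : FreqMomentum L M) (σ : Fin 2) :
    (∑ k₂ : FreqMomentum L M, ∑ k₃ : FreqMomentum L M, ∑ k₄ : FreqMomentum L M,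
        if matsubaraInt M k.1 + matsubaraInt M k₃.1 = matsubaraInt M k₂.1 + matsubaraInt M k₄.1 ∧ k.2 + k₃.2 = k₂.2 + k₄.2 then
          propCT L M β μ 0 k₂ * propCT L M β μ 0 k₃ * propCT L M β μ 0 k₄ else 0) /
        ((β * (L : ℝ) ^ 2 : ℝ) : ℂ) ^ 2 =
      klSunset L M β (fun a x => ((bandCT μ 0 x : ℂ) - Complex.I * (fermiMatsubara β a : ℂ))⁻¹) k σ := by
  set g : ℤ → (Fin 2 → ℝ) → ℂ := fun a x => ((bandCT μ 0 x : ℂ) - Complex.I * (fermiMatsubara β a : ℂ))⁻¹ with hg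
  have hprop : ∀ q : FreqMomentum L M, propCT L M β μ 0 q = g (matsubaraInt M q.1) (latticeMomentum L q.2) := by
    rintro ⟨ι, qv⟩; rw [propCT_zero_eq_bareSymbol]
  obtain ⟨ω, kv⟩ := k
  -- Step 1: move the constrained leg innermost and collapse it
  have hcollapse : (∑ k₂ : FreqMomentum L M, ∑ k₃ : FreqMomentum L M, ∑ k₄ : FreqMomentum L M,
      if matsubaraInt M ω + matsubaraInt M k₃.1 = matsubaraInt M k₂.1 + matsubaraInt M k₄.1 ∧ kv + k₃.2 = k₂.2 + k₄.2 then
        propCT L M β μ 0 k₂ * propCT L M β μ 0 k₃ * propCT L M β μ 0 k₄ else 0) =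
      ∑ k₃ : FreqMomentum L M, ∑ k₄ : FreqMomentum L M,
        if matsubaraInt M ω + matsubaraInt M k₃.1 - matsubaraInt M k₄.1 ∈ Finset.Ico (-(M : ℤ)) M then
          g (matsubaraInt M ω + matsubaraInt M k₃.1 - matsubaraInt M k₄.1) (latticeMomentum L (kv + k₃.2 - k₄.2)) *
            g (matsubaraInt M k₃.1) (latticeMomentum L k₃.2) * g (matsubaraInt M k₄.1) (latticeMomentum L k₄.2)
        else 0 := by
    rw [Finset.sum_comm]
    refine Finset.sum_congr rfl fun k₃ _ => ?_
    rw [Finset.sum_comm]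
    refine Finset.sum_congr rfl fun k₄ _ => ?_
    have h := sum_vertexConstraint_collapse ((ω, kv) : FreqMomentum L M) k₃ k₄
      (fun m v => g m (latticeMomentum L v) * g (matsubaraInt M k₃.1) (latticeMomentum L k₃.2) *
        g (matsubaraInt M k₄.1) (latticeMomentum L k₄.2))
    simp only at h
    rw [← h]
    refine Finset.sum_congr rfl fun k₂ _ => ?_
    rw [hprop k₂, hprop k₃, hprop k₄]
  rw [hcollapse, klSunset_eq_sum, Icc_neg_sub_one_eq_Ico, Finset.sum_product_right]
  -- Step 2: the `k₃`-label becomes `b`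
  rw [Fintype.sum_prod_type, sum_matsubaraIdx_eq_sum_Ico M (fun b => ∑ q : TorusSite 2 L, ∑ k₄ : FreqMomentum L M,
    if matsubaraInt M ω + b - matsubaraInt M k₄.1 ∈ Finset.Ico (-(M : ℤ)) M then
      g (matsubaraInt M ω + b - matsubaraInt M k₄.1) (latticeMomentum L (kv + q - k₄.2)) *
        g b (latticeMomentum L q) * g (matsubaraInt M k₄.1) (latticeMomentum L k₄.2) else 0), Finset.sum_div]
  refine Finset.sum_congr rfl fun b hb => ?_
  -- Step 3: the `k₄`-label becomes `a`, outermost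
  rw [Finset.sum_comm, Fintype.sum_prod_type, sum_matsubaraIdx_eq_sum_Ico M (fun a => ∑ p : TorusSite 2 L, ∑ q : TorusSite 2 L,
    if matsubaraInt M ω + b - a ∈ Finset.Ico (-(M : ℤ)) M then
      g (matsubaraInt M ω + b - a) (latticeMomentum L (kv + q - p)) * g b (latticeMomentum L q) * g a (latticeMomentum L p)
    else 0), Finset.sum_div]
  refine Finset.sum_congr rfl fun a ha => ?_
  -- Step 4: the `(a, b)` term
  unfold klSunsetTerm
  simp only
  rw [Icc_neg_sub_one_eq_Ico, if_congr (Iff.intro (fun h => h.2.2) (fun h => ⟨ha, hb, h⟩)) rfl rfl]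
  split_ifs with hkeep
  · simp only [Finset.smul_sum, Finset.sum_div, Complex.real_smul]
    refine Finset.sum_congr rfl fun p _ => Finset.sum_congr rfl fun q _ => ?_
    have hL : ((L : ℝ) : ℂ) ≠ 0 := by exact_mod_cast NeZero.ne L
    push_cast
    field_simp
  · simp

/-! ## §4 Hence the VL clauses for the sunset part of the `U²`-coefficient -/

/-- **The sunset part of the `U²`-coefficient of the true carrier satisfies the three clauses of `FinalTwoLegVolLimit`**: for every
`β > 0`, `μ` and `Mstar`, the family `Sun_{L,M}(k)/(βL²)²` (bare torus propagator) has a momentum-continuous limit per Matsubara integer,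
an `n`-uniform bound and grid convergence eventually in `L` then `M` (k3c4-p1's `klSunset_frame_volLimit` at the trivial frame, through
`sunsetSum_div_eq_klSunset`). -/
theorem sunsetSum_volLimit {β : ℝ} (hβ : 0 < β) (μ : ℝ) (Mstar : ℕ → ℕ) :
    ∃ sigmaInf : ℤ → (Fin 2 → ℝ) → Fin 2 → ℂ, ∃ B : ℝ, ∃ L₀' : ℕ,
      (∀ (n : ℤ) (σ : Fin 2), Continuous fun p : Fin 2 → ℝ => sigmaInf n p σ) ∧
      (∀ (L : ℕ) [NeZero L], L₀' ≤ L → ∀ (M : ℕ) [NeZero M], Mstar L ≤ M →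
        ∀ (k : FreqMomentum L M) (σ : Fin 2),
          ‖(∑ k₂ : FreqMomentum L M, ∑ k₃ : FreqMomentum L M, ∑ k₄ : FreqMomentum L M,
              if matsubaraInt M k.1 + matsubaraInt M k₃.1 = matsubaraInt M k₂.1 + matsubaraInt M k₄.1 ∧ k.2 + k₃.2 = k₂.2 + k₄.2 then
                propCT L M β μ 0 k₂ * propCT L M β μ 0 k₃ * propCT L M β μ 0 k₄ else 0) /
            ((β * (L : ℝ) ^ 2 : ℝ) : ℂ) ^ 2‖ ≤ B) ∧
      (∀ (n : ℤ) (σ : Fin 2) (ε : ℝ), 0 < ε → ∃ L₁ : ℕ, ∀ (L : ℕ) [NeZero L], L₁ ≤ L →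
        ∃ M₁ : ℕ, ∀ (M : ℕ) [NeZero M], M₁ ≤ M → ∀ ω : MatsubaraIdx M, matsubaraInt M ω = n →
          ∀ k : TorusSite 2 L,
            ‖(∑ k₂ : FreqMomentum L M, ∑ k₃ : FreqMomentum L M, ∑ k₄ : FreqMomentum L M,
                if matsubaraInt M ω + matsubaraInt M k₃.1 = matsubaraInt M k₂.1 + matsubaraInt M k₄.1 ∧ k + k₃.2 = k₂.2 + k₄.2 then
                  propCT L M β μ 0 k₂ * propCT L M β μ 0 k₃ * propCT L M β μ 0 k₄ else 0) /
                ((β * (L : ℝ) ^ 2 : ℝ) : ℂ) ^ 2 -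
              sigmaInf n (latticeMomentum L k) σ‖ ≤ ε) := by
  obtain ⟨sig, B, L₀', hc, hb, hl⟩ := klSunset_frame_volLimit hβ μ 0 Mstar
  refine ⟨sig, B, L₀', hc, ?_, ?_⟩
  · intro L _ hL M _ hM k σ
    rw [sunsetSum_div_eq_klSunset β μ k σ]
    exact hb L hL M hM k σ
  · intro n σ ε hε
    obtain ⟨L₁, hL₁⟩ := hl n σ ε hε
    refine ⟨L₁, fun L _ hL => ?_⟩
    obtain ⟨M₁, hM₁⟩ := hL₁ L hL
    refine ⟨M₁, fun M _ hM ω hω k => ?_⟩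
    have h := hM₁ M hM ω hω k
    rw [← sunsetSum_div_eq_klSunset β μ (ω, k) σ] at h
    exact h

end Summit.HubbardSuperconductivity.HubbardSuperconductivity.Theorems.TwoPointAssembly

end
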